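import Summits.ResolutionOfSingularities.ResolutionOfSingularities.Theorems.EquisingularLiftEquisingularLiftNatEquinodalJInitOfNearNode
import Summits.ResolutionOfSingularities.ResolutionOfSingularities.Theorems.EquisingularLiftEquisingularLiftNatEquinodalCoreNoseRegularNode
import HarnessLib

/-!
# [OURS · L1 W4.5(b) · EL♮(3) · door ν4, brick N-0 (JINIT at `RD := RPlus`)] ★★ `jinit_rPlus₀` UNCONDITIONAL — the registered N-0 signature is a tree theorem

res-L1-w45b-nose-w1 g5 (WIDTH seat D-0157 DOOR 1; N-0 owner, assembler of record).  DEF-FREE; no `sorry`; standard axioms.  `--supports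
stmt-ResolutionOfSingularities-20148 --as helper`, counted 0.

WHAT.  `jinit_rPlus₀ k H ι hι hH E₀ hE₀'` : the JINIT slot of ✓ `Equinodal.hsube_of_suppliers` at `RD := RPlus` (SIG `L/res-L1-w45b-nose-w1/HSUBeBricksSIG-draft2.lean`
l.212 + the engine-context binders `hι hH`; = the conclusion of ✓ `jinit_rPlus₀_of_noseDatum₂` VERBATIM) — «at the INITIAL stage `(ℙ³_O, 𝟙, Proj φ)` the
inner upstairs motive `RPlus` holds: the equinodal planar nose `Z ⊂ V₊(ℓ) ∩ H` (certificate `EqCertAt₀`) lifts to a flat integral nose model `V(λ̃, Ĝ) ⊂ ℙ³_O`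
with reduced special fibre `Z`, node sections through exactly the non-regular points of `Z̃`, each an ordinary node along its section, the model regular
off the sections».  PROOF = ✓ `jinit_rPlus₀_of_nearNode` (N-0 modulo W5b; Levels A₂ p681158 · B₃ p688047 · C₃ p688098 · D p688645 and the cores S4 p686680 ·
S7 p688665 (res-type-027) · S8 p688841 (res-L1-w45b-stub-4) · W5g p688526 (res-L1-w45b-stub-2)) applied to W5b ✓ `nose_regular_near_node`
(res-L1-w45b-stub-2 g18).  EL♮(3) is NOT proved; resolution of singularities in positive characteristic is NOT proved; nothing of [Hironaka2017] is asserted.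
-/

set_option linter.dupNamespace false -- mandated namespace `Summit.<Summit>.<Problem>` of this single-conjunct summit
set_option linter.overlappingInstances false -- signatures carry `[IsDomain O] [IsDiscreteValuationRing O]`

noncomputable section

open CategoryTheory CategoryTheory.Limits AlgebraicGeometry TopologicalSpace Topology IsLocalRing
open MvPolynomial
open Literature.AlgebraicGeometry.Resolution
open AlgebraicGeometry.Scheme.IdealSheafData
open Summit.ResolutionOfSingularities.ResolutionOfSingularities.Theses.EquisingularLift.Split
open Summit.ResolutionOfSingularities.ResolutionOfSingularities.Cruxes.EquisingularLift.StrataSplit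

namespace Summit.ResolutionOfSingularities.ResolutionOfSingularities.Cruxes.EquisingularLiftNat.Sections.Equinodal

/-- ★★ **N-0 `jinit_rPlus₀` (JINIT at `RD := RPlus`), UNCONDITIONAL** — the registered signature (SIG d2 + `hι hH`).  One application of
✓ `jinit_rPlus₀_of_nearNode` to W5b ✓ `nose_regular_near_node`.  See the module docstring. [OURS · brick N-0; counted 0] -/
theorem jinit_rPlus₀ (k : Type) [Field k] [IsAlgClosed k] (H : Scheme.{0})
    (ι : H ⟶ (Literature.AlgebraicGeometry.Motives.projectiveSpace 3 k).left)
    (hι : AlgebraicGeometry.IsClosedImmersion ι) (hH : AlgebraicGeometry.IsIntegral H)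
    (E₀ : Set (Literature.AlgebraicGeometry.Motives.projectiveSpace 3 k).left)
    (hE₀' : letI := MvPolynomial.gradedAlgebra (σ := Fin (3 + 1)) (R := k)
      E₀ = ∅ ∨ ∃ ℓ₀ : MvPolynomial (Fin (3 + 1)) k, ℓ₀.IsHomogeneous 1 ∧ ℓ₀ ≠ 0 ∧
        E₀ = {y : (Literature.AlgebraicGeometry.Motives.projectiveSpace 3 k).left | ℓ₀ ∈ (y : ProjectiveSpectrum (MvPolynomial.homogeneousSubmodule (Fin (3 + 1)) k)).asHomogeneousIdeal}) :
    ∀ (O : Type) [CommRing O] [IsDomain O] [IsDiscreteValuationRing O] [IsAdicComplete (IsLocalRing.maximalIdeal O) O] [IsAlgClosed (IsLocalRing.ResidueField O)] (θ : O →+* k), Function.Surjective θ →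
      (letI := MvPolynomial.gradedAlgebra (σ := Fin (3 + 1)) (R := O); letI := MvPolynomial.gradedAlgebra (σ := Fin (3 + 1)) (R := k);
       ∀ (φ : MvPolynomial.homogeneousSubmodule (Fin (3 + 1)) O →+*ᵍ MvPolynomial.homogeneousSubmodule (Fin (3 + 1)) k)
        (hφ' : HomogeneousIdeal.irrelevant (MvPolynomial.homogeneousSubmodule (Fin (3 + 1)) k) ≤ (HomogeneousIdeal.irrelevant (MvPolynomial.homogeneousSubmodule (Fin (3 + 1)) O)).map φ), (∀ s, φ s = MvPolynomial.map θ s) →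
      ∀ (Ch : ∀ X' : AlgebraicGeometry.Scheme.{0}, (X' ⟶ (AlgebraicGeometry.Proj (MvPolynomial.homogeneousSubmodule (Fin (3 + 1)) O))) → Set X' → Prop),
        (∀ (X' X'' : AlgebraicGeometry.Scheme.{0}) (σ' : X' ⟶ (AlgebraicGeometry.Proj (MvPolynomial.homogeneousSubmodule (Fin (3 + 1)) O))) (S' : Set X') (C : X'.IdealSheafData) (τ : X'' ⟶ X'), Ch X' σ' S' → Literature.AlgebraicGeometry.Resolution.IsBlowup τ C →
          Literature.AlgebraicGeometry.Resolution.Scheme.IsRegular C.subscheme → AlgebraicGeometry.Flat (C.subschemeι ≫ σ' ≫ (AlgebraicGeometry.Proj.toSpecZero (MvPolynomial.homogeneousSubmodule (Fin (3 + 1)) O) ≫ AlgebraicGeometry.Spec.map (CommRingCat.ofHom (algebraMap O (MvPolynomial.homogeneousSubmodule (Fin (3 + 1)) O 0))))) → σ' '' (C.support : Set X') ⊆ {y | ¬ IsGenericPoint y (Set.range (ι ≫ AlgebraicGeometry.Proj.map φ hφ' : H ⟶ (AlgebraicGeometry.Proj (MvPolynomial.homogeneousSubmodule (Fin (3 + 1))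 O))))} →
          (C.support : Set X') ∩ (σ' ≫ (AlgebraicGeometry.Proj.toSpecZero (MvPolynomial.homogeneousSubmodule (Fin (3 + 1)) O) ≫ AlgebraicGeometry.Spec.map (CommRingCat.ofHom (algebraMap O (MvPolynomial.homogeneousSubmodule (Fin (3 + 1)) O 0))))) ⁻¹' {IsLocalRing.closedPoint O} ⊆ S' → Ch X'' (τ ≫ σ') (closure (τ ⁻¹' (S' \ (C.support : Set X'))))) → (∀ (X' : AlgebraicGeometry.Scheme.{0}) (σ' : X' ⟶ (AlgebraicGeometry.Proj (MvPolynomial.homogeneousSubmodule (Fin (3 + 1)) O))) (S' : Set X'), Ch X' σ' S' →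
          Summit.ResolutionOfSingularities.ResolutionOfSingularities.Theses.EquisingularLift.Split.Chain (AlgebraicGeometry.Proj (MvPolynomial.homogeneousSubmodule (Fin (3 + 1)) O)) (Set.range (ι ≫ AlgebraicGeometry.Proj.map φ hφ' : H ⟶ (AlgebraicGeometry.Proj (MvPolynomial.homogeneousSubmodule (Fin (3 + 1)) O)))) X' σ' S') → (Set.range (ι ≫ AlgebraicGeometry.Proj.map φ hφ' : H ⟶ (AlgebraicGeometry.Proj (MvPolynomial.homogeneousSubmodule (Fin (3 + 1)) O)))) ⊆ (AlgebraicGeometry.Proj.toSpecZero (MvPolynomial.homogeneousSubmodule (Fin (3 + 1)) O) ≫ AlgebraicGeometry.Spec.map (CommRingCat.ofHom (algebraMap O (MvPolynomial.homogeneousSubmodule (Fin (3 + 1)) O 0)))) ⁻¹' {IsLocalRing.closedPoint O} → IsIrreducible (Set.range (ι ≫ AlgebraicGeometry.Proj.map φ hφ' : H ⟶ (AlgebraicGeometry.Proj (MvPolynomial.homogeneousSubmodule (Fin (3 + 1)) O)))) → IsClosed (Set.range (ι ≫ AlgebraicGeometry.Proj.map φ hφ' : H ⟶ (AlgebraicGeometry.Proj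 (MvPolynomial.homogeneousSubmodule (Fin (3 + 1)) O)))) →
        AlgebraicGeometry.IsIntegral (AlgebraicGeometry.Proj (MvPolynomial.homogeneousSubmodule (Fin (3 + 1)) O)) → IsLocallyNoetherian (AlgebraicGeometry.Proj (MvPolynomial.homogeneousSubmodule (Fin (3 + 1)) O)) → Literature.AlgebraicGeometry.Resolution.Scheme.IsRegular (AlgebraicGeometry.Proj (MvPolynomial.homogeneousSubmodule (Fin (3 + 1)) O)) → AlgebraicGeometry.IsProper (AlgebraicGeometry.Proj.toSpecZero (MvPolynomial.homogeneousSubmodule (Fin (3 + 1)) O) ≫ AlgebraicGeometry.Spec.map (CommRingCat.ofHom (algebraMap O (MvPolynomial.homogeneousSubmodule (Fin (3 + 1)) O 0)))) → AlgebraicGeometry.SmoothOfRelativeDimension 3 (AlgebraicGeometry.Proj.toSpecZero (MvPolynomial.homogeneousSubmodule (Fin (3 + 1)) O) ≫ AlgebraicGeometry.Spec.map (CommRingCat.ofHom (algebraMap O (MvPolynomial.homogeneousSubmodule (Fin (3 + 1)) O 0)))) →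
      -- the INITIAL stage and the initial host's model
      Ch (AlgebraicGeometry.Proj (MvPolynomial.homogeneousSubmodule (Fin (3 + 1)) O)) (𝟙 (AlgebraicGeometry.Proj (MvPolynomial.homogeneousSubmodule (Fin (3 + 1)) O))) (Set.range (ι ≫ AlgebraicGeometry.Proj.map φ hφ' : H ⟶ (AlgebraicGeometry.Proj (MvPolynomial.homogeneousSubmodule (Fin (3 + 1)) O)))) →
      TCPlus.LetterDatum O (AlgebraicGeometry.Proj (MvPolynomial.homogeneousSubmodule (Fin (3 + 1)) O)) (AlgebraicGeometry.Proj.toSpecZero (MvPolynomial.homogeneousSubmodule (Fin (3 + 1)) O) ≫ AlgebraicGeometry.Spec.map (CommRingCat.ofHom (algebraMap O (MvPolynomial.homogeneousSubmodule (Fin (3 + 1)) O 0)))) (Set.range (ι ≫ AlgebraicGeometry.Proj.map φ hφ' : H ⟶ (AlgebraicGeometry.Proj (MvPolynomial.homogeneousSubmodule (Fin (3 + 1)) O)))) (Literature.AlgebraicGeometry.Motives.projectiveSpace 3 k).left (AlgebraicGeometry.Proj (MvPolynomial.homogeneousSubmodule (Fin (3 + 1)) O)) (𝟙 (AlgebraicGeometry.Proj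 (MvPolynomial.homogeneousSubmodule (Fin (3 + 1)) O))) (AlgebraicGeometry.Proj.map φ hφ' : (Literature.AlgebraicGeometry.Motives.projectiveSpace 3 k).left ⟶ (AlgebraicGeometry.Proj (MvPolynomial.homogeneousSubmodule (Fin (3 + 1)) O))) E₀ →
      ∀ (ℓ : MvPolynomial (Fin (3 + 1)) k),
        E₀ = {y : (Literature.AlgebraicGeometry.Motives.projectiveSpace 3 k).left | ℓ ∈ (y : ProjectiveSpectrum (MvPolynomial.homogeneousSubmodule (Fin (3 + 1)) k)).asHomogeneousIdeal} →
        letI := MvPolynomial.gradedAlgebra (σ := Fin (3 + 1)) (R := k)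
        ∀ (Z : Set (Literature.AlgebraicGeometry.Motives.projectiveSpace 3 k).left) (hZ : IsClosed Z),
        Z ⊆ (Set.range ι) →
        ¬ ((Set.range ι) ⊆ Z) →
        Z.Infinite →
        Z ⊆ {y : (Literature.AlgebraicGeometry.Motives.projectiveSpace 3 k).left | ℓ ∈ (y : ProjectiveSpectrum (MvPolynomial.homogeneousSubmodule (Fin (3 + 1)) k)).asHomogeneousIdeal} →
        IsPreirreducible Z →
        (∀ z : ↥(redSub (Literature.AlgebraicGeometry.Motives.projectiveSpace 3 k).left Z hZ), IsClosed ({z} : Set ↥(redSub (Literature.AlgebraicGeometry.Motives.projectiveSpace 3 k).left Z hZ)) →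
              ringKrullDim ((redSub (Literature.AlgebraicGeometry.Motives.projectiveSpace 3 k).left Z hZ).presheaf.stalk z) = ((1 : ℕ) : WithBot ℕ∞)) →
        (∀ (i : redSub (Literature.AlgebraicGeometry.Motives.projectiveSpace 3 k).left Z hZ ⟶ redSub (Literature.AlgebraicGeometry.Motives.projectiveSpace 3 k).left Set.univ isClosed_univ), i ≫ redSubι (Literature.AlgebraicGeometry.Motives.projectiveSpace 3 k).left Set.univ isClosed_univ = redSubι (Literature.AlgebraicGeometry.Motives.projectiveSpace 3 k).left Z hZ →
              ∀ z : ↥(redSub (Literature.AlgebraicGeometry.Motives.projectiveSpace 3 k).left Z hZ), IsRegularLocalRing ((redSub (Literature.AlgebraicGeometry.Motives.projectiveSpace 3 k).left Set.univ isClosed_univ).presheaf.stalk (i.base z))) →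
        (∀ (i : redSub (Literature.AlgebraicGeometry.Motives.projectiveSpace 3 k).left Z hZ ⟶ redSub (Literature.AlgebraicGeometry.Motives.projectiveSpace 3 k).left (closure {y : (Literature.AlgebraicGeometry.Motives.projectiveSpace 3 k).left | ℓ ∈ (y : ProjectiveSpectrum (MvPolynomial.homogeneousSubmodule (Fin (3 + 1)) k)).asHomogeneousIdeal}) isClosed_closure),
              i ≫ redSubι (Literature.AlgebraicGeometry.Motives.projectiveSpace 3 k).left (closure {y : (Literature.AlgebraicGeometry.Motives.projectiveSpace 3 k).left | ℓ ∈ (y : ProjectiveSpectrum (MvPolynomial.homogeneousSubmodule (Fin (3 + 1)) k)).asHomogeneousIdeal}) isClosed_closure = redSubι (Literature.AlgebraicGeometry.Motives.projectiveSpace 3 k).left Z hZ →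
              ∀ z : ↥(redSub (Literature.AlgebraicGeometry.Motives.projectiveSpace 3 k).left Z hZ), IsRegularLocalRing ((redSub (Literature.AlgebraicGeometry.Motives.projectiveSpace 3 k).left (closure {y : (Literature.AlgebraicGeometry.Motives.projectiveSpace 3 k).left | ℓ ∈ (y : ProjectiveSpectrum (MvPolynomial.homogeneousSubmodule (Fin (3 + 1)) k)).asHomogeneousIdeal}) isClosed_closure).presheaf.stalk (i.base z))) →
        (∀ e : ↥(redSub (Literature.AlgebraicGeometry.Motives.projectiveSpace 3 k).left (closure {y : (Literature.AlgebraicGeometry.Motives.projectiveSpace 3 k).left | ℓ ∈ (y : ProjectiveSpectrum (MvPolynomial.homogeneousSubmodule (Fin (3 + 1)) k)).asHomogeneousIdeal}) isClosed_closure),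
              IsClosed ({e} : Set ↥(redSub (Literature.AlgebraicGeometry.Motives.projectiveSpace 3 k).left (closure {y : (Literature.AlgebraicGeometry.Motives.projectiveSpace 3 k).left | ℓ ∈ (y : ProjectiveSpectrum (MvPolynomial.homogeneousSubmodule (Fin (3 + 1)) k)).asHomogeneousIdeal}) isClosed_closure)) →
              (redSubι (Literature.AlgebraicGeometry.Motives.projectiveSpace 3 k).left (closure {y : (Literature.AlgebraicGeometry.Motives.projectiveSpace 3 k).left | ℓ ∈ (y : ProjectiveSpectrum (MvPolynomial.homogeneousSubmodule (Fin (3 + 1)) k)).asHomogeneousIdeal}) isClosed_closure e : (Literature.AlgebraicGeometry.Motives.projectiveSpace 3 k).left) ∈ Z →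
              ringKrullDim ((redSub (Literature.AlgebraicGeometry.Motives.projectiveSpace 3 k).left (closure {y : (Literature.AlgebraicGeometry.Motives.projectiveSpace 3 k).left | ℓ ∈ (y : ProjectiveSpectrum (MvPolynomial.homogeneousSubmodule (Fin (3 + 1)) k)).asHomogeneousIdeal}) isClosed_closure).presheaf.stalk e) = ((2 : ℕ) : WithBot ℕ∞)) →
        EqCertAt₀ k 3 ℓ Z hZ →
        RPlus k O θ (AlgebraicGeometry.Proj (MvPolynomial.homogeneousSubmodule (Fin (3 + 1)) O))
          (AlgebraicGeometry.Proj.toSpecZero (MvPolynomial.homogeneousSubmodule (Fin (3 + 1)) O) ≫ AlgebraicGeometry.Spec.map (CommRingCat.ofHom (algebraMap O (MvPolynomial.homogeneousSubmodule (Fin (3 + 1)) O 0))))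
          (Set.range (ι ≫ AlgebraicGeometry.Proj.map φ hφ' : H ⟶ (AlgebraicGeometry.Proj (MvPolynomial.homogeneousSubmodule (Fin (3 + 1)) O)))) Ch
          (Literature.AlgebraicGeometry.Motives.projectiveSpace 3 k).left (𝟙 (Literature.AlgebraicGeometry.Motives.projectiveSpace 3 k).left) (Set.range ι)
          {y : (Literature.AlgebraicGeometry.Motives.projectiveSpace 3 k).left | ℓ ∈ (y : ProjectiveSpectrum (MvPolynomial.homogeneousSubmodule (Fin (3 + 1)) k)).asHomogeneousIdeal} Z) := by
  refine jinit_rPlus₀_of_nearNode k H ι hι hH E₀ hE₀' ?_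
  intro O _ _ _ _ _ θ hθ
  letI := MvPolynomial.gradedAlgebra (σ := Fin (3 + 1)) (R := O)
  letI := MvPolynomial.gradedAlgebra (σ := Fin (3 + 1)) (R := k)
  intro φ hφ' hφ hPint hPnoeth hPreg hqprop hqsm ℓ Z hZ e δ g B c a b v r hg hsq hZeq hℓB hr hcab hmarked hcover hvinj a₀ Bt ct Nt ha₀ hBt hdett
    hcta₀ hψt hsect hkert hVlin Gt nO hGt hGtg hnO hn2 hnode hHess hL hF av dv hav hab 𝔰 h𝔰 w hw
  -- W5b ✓ `nose_regular_near_node` (res-L1-w45b-stub-2 g18), positional over the cores₂ binders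
  exact nose_regular_near_node k O θ hθ φ hφ' hφ hPint hPnoeth hPreg hqprop hqsm ℓ Z hZ e δ g B c a b v r hg hsq hZeq hℓB hr hcab hmarked hcover
    hvinj a₀ Bt ct Nt ha₀ hBt hdett hcta₀ hψt hsect hkert hVlin Gt nO hGt hGtg hnO hn2 hnode hHess hL hF av dv hav hab 𝔰 h𝔰 w hw

end Summit.ResolutionOfSingularities.ResolutionOfSingularities.Cruxes.EquisingularLiftNat.Sections.Equinodal

end
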